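import Mathlib
import HarnessLib
import Literature.Analysis.Fourier.PowerKernelFourierDecay
import Literature.Analysis.Fourier.PowerKernelGradientFourierTransform
import Summits.AtomisticToContinuum.Crystallization.Theorems.HolmgrenBoyleLindFiniteRigidityKernel

/-!
# Route `HolmgrenBoyleLind`: Lennard-Jones force fields of separated sources, part 10 —
layer slices of the kernel: geometry of the plane `(ℝ ∙ u)ᗮ` and the in-plane Fourier transform

Support file for the crux item stmt-AtomisticToContinuum-6075 (`HalfSpaceUniqueContinuation`, line
`registered`; stub-worker of lead c3). On a horizontal plane at signed offset `τ` from a source,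
`z = v + τu` with `v ⊥ u`, `‖u‖ = 1`, a component `⟪e, K(z)⟫` of the Lennard-Jones kernel
`K(z) = ((‖z‖²)⁻⁴ − (‖z‖²)⁻⁷) z` (`ljForce_eq_kernel`) is the SLICE
`(⟪c, v⟫ + τ e_u) ((‖v‖² + τ²)^{-4} − (‖v‖² + τ²)^{-7})`, `c = P e`, `e_u = ⟪e, u⟫`
(`hbl_inner_kernel_coe_add_smul`). For an abstract 2-dimensional `V` (later `(ℝ ∙ u)ᗮ`):
continuity, integrability, a pointwise bound and a summable lattice majorant of the slice (uniform
in `|τ| ≥ tₘ`), its FOURIER TRANSFORM `𝓕[slice](w) = −πi ⟪c, w⟫ (F₃/3 − F₆/6) + τ e_u (F₄ − F₇)`,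
`F_s = 𝓕[(‖·‖² + τ²)^{-s}](w)` (registered stub `hbl_fourierIntegral_slice`), and the SHELL BOUND
`‖𝓕[slice](w)‖ ≤ K (‖c‖ ‖w‖ + |e_u|) |τ|⁻⁴ e^{−π ‖w‖ |τ|}`. All `[folklore]`; nothing here closes
an item.
-/

noncomputable section

namespace Summit.AtomisticToContinuum.Crystallization.Theorems.HolmgrenBoyleLind

open scoped BigOperators Topology InnerProductSpace RealInnerProductSpace FourierTransform
open MeasureTheory Filter Set Literature.Analysis.Fourier

/-- The orthogonal complement of a non-zero vector of `ℝ³` is a plane. [folklore] -/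
theorem hbl_finrank_orthogonal_span_singleton {u : EuclideanSpace ℝ (Fin 3)} (hu : u ≠ 0) :
    Module.finrank ℝ (ℝ ∙ u)ᗮ = 2 := by
  haveI : Fact (Module.finrank ℝ (EuclideanSpace ℝ (Fin 3)) = 2 + 1) := ⟨by simp⟩
  exact Submodule.finrank_orthogonal_span_singleton hu

/-- Vectors of `(ℝ ∙ u)ᗮ` are orthogonal to `u`. [folklore] -/
theorem hbl_inner_coe_orthogonal (u : EuclideanSpace ℝ (Fin 3)) (v : (ℝ ∙ u)ᗮ) :
    ⟪(v : EuclideanSpace ℝ (Fin 3)), u⟫ = 0 :=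
  Submodule.mem_orthogonal_singleton_iff_inner_left.1 v.2

/-- Pythagoras on a slice: `‖v + τu‖² = ‖v‖² + τ²` for `v ⊥ u`, `‖u‖ = 1`. [folklore] -/
theorem hbl_norm_sq_coe_add_smul {u : EuclideanSpace ℝ (Fin 3)} (hu : ‖u‖ = 1) (v : (ℝ ∙ u)ᗮ)
    (τ : ℝ) : ‖(v : EuclideanSpace ℝ (Fin 3)) + τ • u‖ ^ 2 = ‖v‖ ^ 2 + τ ^ 2 := by
  rw [norm_add_sq_real, real_inner_smul_right, hbl_inner_coe_orthogonal u v, mul_zero, mul_zero,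
    add_zero, norm_smul, hu, mul_one, Real.norm_eq_abs, sq_abs, Submodule.coe_norm]

/-- Components on a slice: `⟪e, v + τu⟫ = ⟪P e, v⟫ + τ ⟪e, u⟫` with `P` the orthogonal projection
onto `(ℝ ∙ u)ᗮ` (valid for any `u`; stated for a unit normal). [folklore] -/
theorem hbl_inner_coe_add_smul {u : EuclideanSpace ℝ (Fin 3)} (_hu : ‖u‖ = 1)
    (e : EuclideanSpace ℝ (Fin 3)) (v : (ℝ ∙ u)ᗮ) (τ : ℝ) :
    ⟪e, (v : EuclideanSpace ℝ (Fin 3)) + τ • u⟫ =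
      ⟪(ℝ ∙ u)ᗮ.orthogonalProjectionOnto e, v⟫ + τ * ⟪e, u⟫ := by
  rw [inner_add_right, real_inner_smul_right,
    Submodule.inner_orthogonalProjectionOnto_eq_of_mem_right]

/-- The decomposition `z = P z + ⟪z, u⟫ u` (`‖u‖ = 1`). [folklore] -/
theorem hbl_eq_proj_add_inner_smul {u : EuclideanSpace ℝ (Fin 3)} (hu : ‖u‖ = 1)
    (z : EuclideanSpace ℝ (Fin 3)) :
    z = ((ℝ ∙ u)ᗮ.orthogonalProjectionOnto z : EuclideanSpace ℝ (Fin 3)) + ⟪z, u⟫ • u := by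
  rw [← Submodule.starProjection_apply, Submodule.starProjection_orthogonal_val,
    Submodule.starProjection_unit_singleton ℝ hu, real_inner_comm z u, sub_add_cancel]

/-- **The slice identity.** On the plane at signed offset `τ` (`v ⊥ u`, `‖u‖ = 1`, `τ ≠ 0`), a
component of the Lennard-Jones kernel `K(z) = ((‖z‖²)⁻⁴ − (‖z‖²)⁻⁷) z` is
`⟪e, K(v + τu)⟫ = (⟪P e, v⟫ + τ ⟪e, u⟫) ((‖v‖² + τ²)^{-4} − (‖v‖² + τ²)^{-7})`. [folklore] -/
theorem hbl_inner_kernel_coe_add_smul {u : EuclideanSpace ℝ (Fin 3)} (hu : ‖u‖ = 1)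
    (e : EuclideanSpace ℝ (Fin 3)) (v : (ℝ ∙ u)ᗮ) {τ : ℝ} (hτ : τ ≠ 0) :
    ⟪e, ((((‖(v : EuclideanSpace ℝ (Fin 3)) + τ • u‖ ^ 2) ^ 4)⁻¹ -
        ((‖(v : EuclideanSpace ℝ (Fin 3)) + τ • u‖ ^ 2) ^ 7)⁻¹) •
      ((v : EuclideanSpace ℝ (Fin 3)) + τ • u))⟫ =
      (⟪(ℝ ∙ u)ᗮ.orthogonalProjectionOnto e, v⟫ + τ * ⟪e, u⟫) *
        ((‖v‖ ^ 2 + τ ^ 2) ^ (-(4 : ℝ)) - (‖v‖ ^ 2 + τ ^ 2) ^ (-(7 : ℝ))) := by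
  have hr : 0 < ‖v‖ ^ 2 + τ ^ 2 := by positivity
  rw [real_inner_smul_right, hbl_norm_sq_coe_add_smul hu, hbl_inner_coe_add_smul hu,
    Real.rpow_neg hr.le, Real.rpow_neg hr.le]
  norm_num
  ring

section Slice

variable {V : Type*} [NormedAddCommGroup V] [InnerProductSpace ℝ V] [FiniteDimensional ℝ V]
  [MeasurableSpace V] [BorelSpace V]

omit [FiniteDimensional ℝ V] [MeasurableSpace V] [BorelSpace V] in
/-- The slice `(⟪c, v⟫ + τ e_u) ((‖v‖² + τ²)^{-4} − (‖v‖² + τ²)^{-7})` is continuous (`τ ≠ 0`).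
[folklore] -/
theorem hbl_continuous_slice (c : V) (eu : ℝ) {τ : ℝ} (hτ : τ ≠ 0) :
    Continuous fun v : V =>
      (⟪c, v⟫ + τ * eu) * ((‖v‖ ^ 2 + τ ^ 2) ^ (-(4 : ℝ)) - (‖v‖ ^ 2 + τ ^ 2) ^ (-(7 : ℝ))) :=
  ((continuous_const.inner continuous_id).add continuous_const).mul
    ((continuous_normSq_add_sq_rpow hτ _).sub (continuous_normSq_add_sq_rpow hτ _))

/-- The four integrable pieces of the slice (`dim V = 2`, `τ ≠ 0`): the vector kernels
`⟪c, ·⟫ (‖·‖² + τ²)^{-s}` (`s = 4, 7 > 3/2`), the scalar kernels `(‖·‖² + τ²)^{-s}`. [folklore] -/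
theorem hbl_integrable_slice_pieces (hV : Module.finrank ℝ V = 2) (c : V) {τ : ℝ} (hτ : τ ≠ 0) :
    Integrable (fun v : V => ((⟪c, v⟫ * (‖v‖ ^ 2 + τ ^ 2) ^ (-(4 : ℝ)) : ℝ) : ℂ)) ∧
    Integrable (fun v : V => ((⟪c, v⟫ * (‖v‖ ^ 2 + τ ^ 2) ^ (-(7 : ℝ)) : ℝ) : ℂ)) ∧
    Integrable (fun v : V => (((‖v‖ ^ 2 + τ ^ 2) ^ (-(4 : ℝ)) : ℝ) : ℂ)) ∧
    Integrable (fun v : V => (((‖v‖ ^ 2 + τ ^ 2) ^ (-(7 : ℝ)) : ℝ) : ℂ)) := by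
  have hd : (Module.finrank ℝ V : ℝ) = 2 := by rw [hV]; norm_num
  exact ⟨(integrable_inner_mul_normSq_add_sq_rpow_neg (by rw [hd]; norm_num) hτ c).ofReal,
    (integrable_inner_mul_normSq_add_sq_rpow_neg (by rw [hd]; norm_num) hτ c).ofReal,
    (integrable_normSq_add_sq_rpow_neg (by rw [hd]; norm_num) hτ).ofReal,
    (integrable_normSq_add_sq_rpow_neg (by rw [hd]; norm_num) hτ).ofReal⟩

omit [FiniteDimensional ℝ V] [MeasurableSpace V] [BorelSpace V] in
/-- Pointwise splitting of the (complexified) slice into its four power-kernel pieces.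
[folklore] -/
theorem hbl_slice_eq_pieces (c : V) (eu τ : ℝ) :
    (fun v : V => ((((⟪c, v⟫ + τ * eu) *
        ((‖v‖ ^ 2 + τ ^ 2) ^ (-(4 : ℝ)) - (‖v‖ ^ 2 + τ ^ 2) ^ (-(7 : ℝ)))) : ℝ) : ℂ)) =
      fun v : V => (((⟪c, v⟫ * (‖v‖ ^ 2 + τ ^ 2) ^ (-(4 : ℝ)) : ℝ) : ℂ) -
          ((⟪c, v⟫ * (‖v‖ ^ 2 + τ ^ 2) ^ (-(7 : ℝ)) : ℝ) : ℂ)) + ((τ * eu : ℝ) : ℂ) *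
        ((((‖v‖ ^ 2 + τ ^ 2) ^ (-(4 : ℝ)) : ℝ) : ℂ) -
          (((‖v‖ ^ 2 + τ ^ 2) ^ (-(7 : ℝ)) : ℝ) : ℂ)) := by
  funext v; push_cast; ring

/-- The slice is integrable when `dim V = 2` (`τ ≠ 0`). [folklore] -/
theorem hbl_integrable_slice (hV : Module.finrank ℝ V = 2) (c : V) (eu : ℝ) {τ : ℝ} (hτ : τ ≠ 0) :
    Integrable fun v : V =>
      (((⟪c, v⟫ + τ * eu) * ((‖v‖ ^ 2 + τ ^ 2) ^ (-(4 : ℝ)) - (‖v‖ ^ 2 + τ ^ 2) ^ (-(7 : ℝ))) : ℝ) :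
        ℂ) := by
  obtain ⟨i4v, i7v, i4, i7⟩ := hbl_integrable_slice_pieces hV c hτ
  rw [hbl_slice_eq_pieces]
  exact (i4v.sub i7v).add ((i4.sub i7).const_mul _)

omit [FiniteDimensional ℝ V] [MeasurableSpace V] [BorelSpace V] in
/-- Pointwise bound: for `|τ| ≥ tₘ > 0`,
`|slice(v)| ≤ (1 + tₘ⁻⁶) (‖c‖ + |e_u|) (‖v‖² + τ²)^{-7/2}`. [folklore] -/
theorem hbl_norm_slice_le (c : V) (eu : ℝ) {tₘ τ : ℝ} (htₘ : 0 < tₘ) (hτ : tₘ ≤ |τ|) (v : V) :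
    ‖(⟪c, v⟫ + τ * eu) * ((‖v‖ ^ 2 + τ ^ 2) ^ (-(4 : ℝ)) - (‖v‖ ^ 2 + τ ^ 2) ^ (-(7 : ℝ)))‖ ≤
      (1 + tₘ⁻¹ ^ 6) * (‖c‖ + |eu|) * (‖v‖ ^ 2 + τ ^ 2) ^ (-(7 / 2 : ℝ)) := by
  have hτsq : tₘ ^ 2 ≤ τ ^ 2 := by
    rw [← sq_abs τ]
    exact pow_le_pow_left₀ htₘ.le hτ 2
  set r : ℝ := ‖v‖ ^ 2 + τ ^ 2 with hr_def
  have hrt : tₘ ^ 2 ≤ r := hτsq.trans (by rw [hr_def]; nlinarith [sq_nonneg ‖v‖])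
  have hr : 0 < r := lt_of_lt_of_le (by positivity) hrt
  -- the linear factor: `|⟪c, v⟫ + τ e_u| ≤ (‖c‖ + |e_u|) √r`
  have hv : ‖v‖ ≤ Real.sqrt r := Real.le_sqrt_of_sq_le (by rw [hr_def]; nlinarith [sq_nonneg τ])
  have hτr : |τ| ≤ Real.sqrt r := Real.abs_le_sqrt (by rw [hr_def]; nlinarith [sq_nonneg ‖v‖])
  have h1 : |⟪c, v⟫ + τ * eu| ≤ (‖c‖ + |eu|) * Real.sqrt r :=
    calc |⟪c, v⟫ + τ * eu| ≤ |⟪c, v⟫| + |τ * eu| := abs_add_le _ _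
      _ ≤ ‖c‖ * ‖v‖ + |τ| * |eu| := add_le_add (abs_real_inner_le_norm c v) (abs_mul τ eu).le
      _ ≤ ‖c‖ * Real.sqrt r + Real.sqrt r * |eu| :=
          add_le_add (mul_le_mul_of_nonneg_left hv (norm_nonneg _))
            (mul_le_mul_of_nonneg_right hτr (abs_nonneg _))
      _ = (‖c‖ + |eu|) * Real.sqrt r := by ring
  -- the radial factor: `|r^{-4} - r^{-7}| ≤ (1 + tₘ⁻⁶) r^{-4}`
  have h3 : r ^ (-(3 : ℝ)) ≤ tₘ⁻¹ ^ 6 := by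
    refine (Real.rpow_le_rpow_of_nonpos (by positivity) hrt (by norm_num)).trans_eq ?_
    rw [Real.rpow_neg (by positivity), inv_pow, show (3 : ℝ) = ((3 : ℕ) : ℝ) by norm_num,
      Real.rpow_natCast]
    ring
  have h7 : r ^ (-(7 : ℝ)) = r ^ (-(4 : ℝ)) * r ^ (-(3 : ℝ)) := by rw [← Real.rpow_add hr]; norm_num
  have h2 : |r ^ (-(4 : ℝ)) - r ^ (-(7 : ℝ))| ≤ (1 + tₘ⁻¹ ^ 6) * r ^ (-(4 : ℝ)) :=
    calc |r ^ (-(4 : ℝ)) - r ^ (-(7 : ℝ))| ≤ |r ^ (-(4 : ℝ))| + |r ^ (-(7 : ℝ))| := abs_sub _ _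
      _ = r ^ (-(4 : ℝ)) + r ^ (-(4 : ℝ)) * r ^ (-(3 : ℝ)) := by
          rw [abs_of_nonneg (Real.rpow_nonneg hr.le _), abs_of_nonneg (Real.rpow_nonneg hr.le _),
            h7]
      _ ≤ r ^ (-(4 : ℝ)) + r ^ (-(4 : ℝ)) * tₘ⁻¹ ^ 6 := by gcongr
      _ = (1 + tₘ⁻¹ ^ 6) * r ^ (-(4 : ℝ)) := by ring
  rw [norm_mul, Real.norm_eq_abs, Real.norm_eq_abs]
  calc |⟪c, v⟫ + τ * eu| * |r ^ (-(4 : ℝ)) - r ^ (-(7 : ℝ))|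
      ≤ (‖c‖ + |eu|) * Real.sqrt r * ((1 + tₘ⁻¹ ^ 6) * r ^ (-(4 : ℝ))) :=
        mul_le_mul h1 h2 (abs_nonneg _) (by positivity)
    _ = (1 + tₘ⁻¹ ^ 6) * (‖c‖ + |eu|) * (Real.sqrt r * r ^ (-(4 : ℝ))) := by ring
    _ = (1 + tₘ⁻¹ ^ 6) * (‖c‖ + |eu|) * r ^ (-(7 / 2 : ℝ)) := by
        rw [Real.sqrt_eq_rpow, ← Real.rpow_add hr]
        norm_num

omit [MeasurableSpace V] [BorelSpace V] in
/-- **Summable majorant of the lattice translates of the slice**, uniform in `|τ| ≥ tₘ` and in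
`‖x‖ ≤ R`: for a full lattice `Λ ≤ V` (`dim V = 2`) there is a summable `M : Λ → ℝ` with
`|slice(x + ℓ)| ≤ (‖c‖ + |e_u|) M ℓ` (`M ℓ = (1 + tₘ⁻⁶) (κ (‖ℓ‖ + tₘ))⁻⁷`, `κ = tₘ / (2 (R + tₘ))`,
as `(‖x + ℓ‖² + τ²)^{1/2} ≥ max (tₘ, ‖ℓ‖ − R) ≥ κ (‖ℓ‖ + tₘ)`; `ZLattice.summable_norm_rpow`).
[folklore] -/
theorem hbl_exists_summable_majorant_slice (hV : Module.finrank ℝ V = 2) (Λ : Submodule ℤ V)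
    [DiscreteTopology Λ] [IsZLattice ℝ Λ] {R tₘ : ℝ} (hR : 0 ≤ R) (htₘ : 0 < tₘ) :
    ∃ M : Λ → ℝ, Summable M ∧ (∀ ℓ, 0 ≤ M ℓ) ∧
      ∀ (c : V) (eu τ : ℝ), tₘ ≤ |τ| → ∀ (ℓ : Λ) (x : V), ‖x‖ ≤ R →
        ‖(⟪c, x + ℓ⟫ + τ * eu) *
            ((‖x + ℓ‖ ^ 2 + τ ^ 2) ^ (-(4 : ℝ)) - (‖x + ℓ‖ ^ 2 + τ ^ 2) ^ (-(7 : ℝ)))‖ ≤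
          (‖c‖ + |eu|) * M ℓ := by
  set κ : ℝ := tₘ / (2 * (R + tₘ)) with hκ_def
  have hκ : 0 < κ := div_pos htₘ (by positivity)
  have key : ∀ s m : ℝ, 0 ≤ s → tₘ ≤ m → s - R ≤ m → κ * (s + tₘ) ≤ m := by
    intro s m hs hm1 hm2
    rw [hκ_def, div_mul_eq_mul_div, div_le_iff₀ (by positivity : (0 : ℝ) < 2 * (R + tₘ))]
    rcases le_or_gt s (tₘ + 2 * R) with h | h
    · nlinarith [mul_le_mul_of_nonneg_right hm1 (by positivity : (0 : ℝ) ≤ 2 * (R + tₘ))]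
    · nlinarith [mul_le_mul_of_nonneg_right hm2 (by positivity : (0 : ℝ) ≤ 2 * (R + tₘ)),
        mul_nonneg hR (sub_nonneg.2 h.le), mul_nonneg htₘ.le (sub_nonneg.2 h.le)]
  refine ⟨fun ℓ => (1 + tₘ⁻¹ ^ 6) * (κ * (‖(ℓ : V)‖ + tₘ)) ^ (-(7 : ℝ)), ?_,
    fun ℓ => by positivity, ?_⟩
  · have hrank : (-7 : ℝ) < -(Module.finrank ℤ Λ : ℝ) := by rw [ZLattice.rank ℝ Λ, hV]; norm_num
    refine Summable.of_norm_bounded_eventually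
      ((((ZLattice.summable_norm_rpow Λ (-7) hrank).mul_left (κ ^ (-(7 : ℝ)))).mul_left
        (1 + tₘ⁻¹ ^ 6))) ?_
    refine Filter.eventually_cofinite.2 ((Set.finite_singleton (0 : Λ)).subset fun ℓ hℓ => ?_)
    rw [Set.mem_singleton_iff]
    by_contra h0
    refine absurd ?_ hℓ
    have hℓ0 : 0 < ‖(ℓ : V)‖ := norm_pos_iff.2 fun h => h0 (by exact_mod_cast h)
    rw [Real.norm_of_nonneg (by positivity), Submodule.coe_norm, ← Real.mul_rpow hκ.le hℓ0.le]
    exact mul_le_mul_of_nonneg_left (Real.rpow_le_rpow_of_nonpos (by positivity)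
      (by nlinarith) (by norm_num)) (by positivity)
  · intro c eu τ hτ ℓ x hx
    have hy : ‖(ℓ : V)‖ - R ≤ ‖x + ℓ‖ := by linarith [norm_le_add_norm_add' x (ℓ : V)]
    set r : ℝ := ‖x + (ℓ : V)‖ ^ 2 + τ ^ 2 with hr_def
    have hr : 0 < r := lt_of_lt_of_le (by positivity : (0 : ℝ) < tₘ ^ 2) (by
      rw [hr_def, ← sq_abs τ]; nlinarith [pow_le_pow_left₀ htₘ.le hτ 2, sq_nonneg ‖x + (ℓ : V)‖])
    have hy2 : ‖x + (ℓ : V)‖ ≤ Real.sqrt r :=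
      Real.le_sqrt_of_sq_le (by rw [hr_def]; nlinarith [sq_nonneg τ])
    have hm1 : tₘ ≤ Real.sqrt r :=
      hτ.trans (Real.abs_le_sqrt (by rw [hr_def]; nlinarith [sq_nonneg ‖x + (ℓ : V)‖]))
    have hκm : κ * (‖(ℓ : V)‖ + tₘ) ≤ Real.sqrt r := key _ _ (norm_nonneg _) hm1 (hy.trans hy2)
    have hpow : r ^ (-(7 / 2 : ℝ)) ≤ (κ * (‖(ℓ : V)‖ + tₘ)) ^ (-(7 : ℝ)) := by
      rw [show (-(7 / 2 : ℝ)) = 1 / 2 * -7 by norm_num, Real.rpow_mul hr.le, ← Real.sqrt_eq_rpow]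
      exact Real.rpow_le_rpow_of_nonpos (by positivity) hκm (by norm_num)
    calc _ ≤ (1 + tₘ⁻¹ ^ 6) * (‖c‖ + |eu|) * r ^ (-(7 / 2 : ℝ)) :=
          hbl_norm_slice_le c eu htₘ hτ (x + ℓ)
      _ ≤ (1 + tₘ⁻¹ ^ 6) * (‖c‖ + |eu|) * (κ * (‖(ℓ : V)‖ + tₘ)) ^ (-(7 : ℝ)) :=
          mul_le_mul_of_nonneg_left hpow (by positivity)
      _ = (‖c‖ + |eu|) * ((1 + tₘ⁻¹ ^ 6) * (κ * (‖(ℓ : V)‖ + tₘ)) ^ (-(7 : ℝ))) := by ring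

/-- Additivity of the Fourier integral of integrable functions, pointwise form. [folklore] -/
theorem hbl_fourier_add_apply {f g : V → ℂ} (hf : Integrable f) (hg : Integrable g) (w : V) :
    𝓕 (f + g) w = 𝓕 f w + 𝓕 g w := by
  simp only [Real.fourier_eq, Pi.add_apply, smul_add]
  exact integral_add ((Real.fourierIntegral_convergent_iff w).2 hf)
    ((Real.fourierIntegral_convergent_iff w).2 hg)

/-- The Fourier integral of a difference of integrable functions, pointwise form. [folklore] -/
theorem hbl_fourier_sub_apply {f g : V → ℂ} (hf : Integrable f) (hg : Integrable g) (w : V) :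
    𝓕 (f - g) w = 𝓕 f w - 𝓕 g w := by
  simp only [Real.fourier_eq, Pi.sub_apply, smul_sub]
  exact integral_sub ((Real.fourierIntegral_convergent_iff w).2 hf)
    ((Real.fourierIntegral_convergent_iff w).2 hg)

/-- Constants come out of the Fourier integral, pointwise form. [folklore] -/
theorem hbl_fourier_const_mul_apply (a : ℂ) (f : V → ℂ) (w : V) :
    𝓕 (fun v => a * f v) w = a * 𝓕 f w := by
  rw [Real.fourier_eq, Real.fourier_eq, ← integral_const_mul]
  exact integral_congr_ae (ae_of_all _ fun v => by simp only [Circle.smul_def, smul_eq_mul]; ring)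

/-- **The in-plane Fourier transform of the slice** (`dim V = 2`, `τ ≠ 0`), with
`F_s = 𝓕[(‖·‖² + τ²)^{-s}]`: `𝓕[slice](w) = −πi ⟪c, w⟫ (F₃(w)/3 − F₆(w)/6) + τ e_u (F₄(w) − F₇(w))`
(`s = 4, 7`); universe-polymorphic form of the registered `hbl_fourierIntegral_slice`. [folklore] -/
theorem hbl_fourierIntegral_slice' (hV : Module.finrank ℝ V = 2) (c : V) (eu : ℝ) {τ : ℝ}
    (hτ : τ ≠ 0) (w : V) :
    𝓕 (fun v : V =>
      ((((⟪c, v⟫ + τ * eu) * ((‖v‖ ^ 2 + τ ^ 2) ^ (-(4 : ℝ)) - (‖v‖ ^ 2 + τ ^ 2) ^ (-(7 : ℝ)))) :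
        ℝ) : ℂ)) w =
      -(Real.pi * Complex.I * (⟪c, w⟫ : ℝ)) *
          ((1 / 3 : ℂ) * 𝓕 (fun v : V => (((‖v‖ ^ 2 + τ ^ 2) ^ (-(3 : ℝ)) : ℝ) : ℂ)) w -
            (1 / 6 : ℂ) * 𝓕 (fun v : V => (((‖v‖ ^ 2 + τ ^ 2) ^ (-(6 : ℝ)) : ℝ) : ℂ)) w) +
        ((τ * eu : ℝ) : ℂ) *
          (𝓕 (fun v : V => (((‖v‖ ^ 2 + τ ^ 2) ^ (-(4 : ℝ)) : ℝ) : ℂ)) w -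
            𝓕 (fun v : V => (((‖v‖ ^ 2 + τ ^ 2) ^ (-(7 : ℝ)) : ℝ) : ℂ)) w) := by
  obtain ⟨i4v, i7v, i4, i7⟩ := hbl_integrable_slice_pieces hV c hτ
  have hτ' : 0 < |τ| := abs_pos.2 hτ
  have hd : (Module.finrank ℝ V : ℝ) = 2 := by rw [hV]; norm_num
  -- the vector pieces: `𝓕[⟪c, ·⟫ r^{-s}] = -(πi ⟪c, w⟫ / (s - 1)) 𝓕[r^{-(s-1)}]`, `s = 4, 7`
  have h4 := fourierIntegral_inner_mul_normSq_add_sq_rpow_neg (V := V) (s := 4) (t := |τ|)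
    (by rw [hd]; norm_num) hτ' c w
  have h7 := fourierIntegral_inner_mul_normSq_add_sq_rpow_neg (V := V) (s := 7) (t := |τ|)
    (by rw [hd]; norm_num) hτ' c w
  rw [sq_abs, show (4 : ℝ) - 1 = 3 by norm_num] at h4
  rw [sq_abs, show (7 : ℝ) - 1 = 6 by norm_num] at h7
  rw [hbl_slice_eq_pieces]
  refine (hbl_fourier_add_apply (i4v.sub i7v) ((i4.sub i7).const_mul ((τ * eu : ℝ) : ℂ)) w).trans ?_
  rw [hbl_fourier_sub_apply i4v i7v, hbl_fourier_const_mul_apply, hbl_fourier_sub_apply i4 i7, h4,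
    h7]
  push_cast
  ring

open FourierTransform renaming fourier → Real.fourierIntegral in
/-- **The in-plane Fourier transform of the slice**, registered form (`V : Type`; the registry
spells Mathlib's `𝓕 = FourierTransform.fourier` by its former name `Real.fourierIntegral`, aliased
by the `open … renaming` above so that the registered header elaborates verbatim). [folklore] -/
theorem hbl_fourierIntegral_slice : ∀ {V : Type} [NormedAddCommGroup V] [InnerProductSpace ℝ V]
    [FiniteDimensional ℝ V] [MeasurableSpace V] [BorelSpace V], Module.finrank ℝ V = 2 → ∀ (c : V)
    (eu : ℝ) {τ : ℝ}, τ ≠ 0 → ∀ w : V, Real.fourierIntegral (fun v : V => ((((inner ℝ c v + τ * eu)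
    * ((‖v‖ ^ 2 + τ ^ 2) ^ (-(4 : ℝ)) - (‖v‖ ^ 2 + τ ^ 2) ^ (-(7 : ℝ)))) : ℝ) : ℂ)) w = -(Real.pi *
    Complex.I * (inner ℝ c w : ℝ)) * ((1 / 3 : ℂ) * Real.fourierIntegral (fun v : V => (((‖v‖ ^ 2 +
    τ ^ 2) ^ (-(3 : ℝ)) : ℝ) : ℂ)) w - (1 / 6 : ℂ) * Real.fourierIntegral (fun v : V => (((‖v‖ ^ 2 +
    τ ^ 2) ^ (-(6 : ℝ)) : ℝ) : ℂ)) w) + ((τ * eu : ℝ) : ℂ) * (Real.fourierIntegral (fun v : V =>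
    (((‖v‖ ^ 2 + τ ^ 2) ^ (-(4 : ℝ)) : ℝ) : ℂ)) w - Real.fourierIntegral (fun v : V => (((‖v‖ ^ 2 +
    τ ^ 2) ^ (-(7 : ℝ)) : ℝ) : ℂ)) w) := by
  intro V _ _ _ _ _ hV c eu τ hτ w
  exact hbl_fourierIntegral_slice' hV c eu hτ w

/-- The shell bound for the scalar power kernels in dimension `2`: for `s > 1`, `2s - 2 = n` and
`τ ≠ 0`, `‖𝓕[(‖·‖² + τ²)^{-s}](w)‖ ≤ (π/(s-1)) 2ⁿ |τ|⁻ⁿ e^{-π ‖w‖ |τ|}` (the Literature shell bound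
with `t = |τ|`, `t₀ = |τ|/2`, and `∫ (‖v‖² + t₀²)^{-s} = π Γ(s-1)/Γ(s) · t₀^{2-2s}`). [folklore] -/
theorem hbl_norm_fourier_powerKernel_le (hV : Module.finrank ℝ V = 2) {s : ℝ} {n : ℕ}
    (hs : 1 < s) (hn : 2 * s - 2 = n) {τ : ℝ} (hτ : τ ≠ 0) (w : V) :
    ‖𝓕 (fun v : V => (((‖v‖ ^ 2 + τ ^ 2) ^ (-s) : ℝ) : ℂ)) w‖ ≤
      Real.pi / (s - 1) * 2 ^ n * |τ|⁻¹ ^ n * Real.exp (-(Real.pi * ‖w‖ * |τ|)) := by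
  have hd : (Module.finrank ℝ V : ℝ) = 2 := by rw [hV]; norm_num
  have ht : 0 < |τ| := abs_pos.2 hτ
  have hs' : (Module.finrank ℝ V : ℝ) / 2 < s := by rw [hd]; linarith
  have h := norm_fourierIntegral_normSq_add_sq_rpow_neg_le hs' (half_pos ht) (half_le_self ht.le) w
  rw [integral_normSq_add_sq_rpow_neg hs' (half_pos ht), hd, sq_abs] at h
  have hG1 : 0 < Real.Gamma (s - 1) := Real.Gamma_pos_of_pos (by linarith)
  have hG := (sub_add_cancel s 1) ▸ Real.Gamma_add_one (s := s - 1) (by linarith)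
  have e1 : Real.pi ^ ((2 : ℝ) / 2) * Real.Gamma (s - (2 : ℝ) / 2) / Real.Gamma s =
      Real.pi / (s - 1) := by
    rw [show (2 : ℝ) / 2 = 1 by norm_num, Real.rpow_one, hG]
    field_simp [hG1.ne', (show s - 1 ≠ 0 by linarith)]
  have e2 : (|τ| / 2) ^ ((2 : ℝ) - 2 * s) = 2 ^ n * |τ|⁻¹ ^ n := by
    rw [show (2 : ℝ) - 2 * s = -(n : ℝ) by linarith, Real.rpow_neg (by positivity),
      Real.rpow_natCast, ← inv_pow, inv_div, div_eq_mul_inv, mul_pow]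
  have e3 : 2 * Real.pi * ‖w‖ * (|τ| - |τ| / 2) = Real.pi * ‖w‖ * |τ| := by ring
  rw [e1, e2, e3] at h
  exact h.trans_eq (by ring)

/-- **Shell bound for the slice transform** (`dim V = 2`): for `tₘ > 0` there is `K` such that for
all `c, e_u`, `|τ| ≥ tₘ`, `w`: `‖𝓕[slice](w)‖ ≤ K (‖c‖ ‖w‖ + |e_u|) |τ|⁻⁴ e^{−π ‖w‖ |τ|}`
(`hbl_fourierIntegral_slice'`, `hbl_norm_fourier_powerKernel_le` for `s = 3, 6, 4, 7`, and, with
`u = |τ|⁻¹ ≤ tₘ⁻¹`: `u¹⁰ ≤ tₘ⁻⁶ u⁴`, `|τ| u⁶ ≤ tₘ⁻¹ u⁴`, `|τ| u¹² ≤ tₘ⁻⁷ u⁴`). [folklore] -/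
theorem hbl_exists_norm_fourierIntegral_slice_le (hV : Module.finrank ℝ V = 2) {tₘ : ℝ}
    (htₘ : 0 < tₘ) :
    ∃ K : ℝ, 0 ≤ K ∧ ∀ (c : V) (eu τ : ℝ), tₘ ≤ |τ| → ∀ w : V,
      ‖𝓕 (fun v : V =>
        ((((⟪c, v⟫ + τ * eu) * ((‖v‖ ^ 2 + τ ^ 2) ^ (-(4 : ℝ)) - (‖v‖ ^ 2 + τ ^ 2) ^ (-(7 : ℝ)))) :
          ℝ) : ℂ)) w‖ ≤
        K * (‖c‖ * ‖w‖ + |eu|) * |τ|⁻¹ ^ 4 * Real.exp (-(Real.pi * ‖w‖ * |τ|)) := by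
  refine ⟨Real.pi * (Real.pi / (3 - 1) * 2 ^ 4 / 3 + Real.pi / (6 - 1) * 2 ^ 10 / 6 * tₘ⁻¹ ^ 6) +
      (Real.pi / (4 - 1) * 2 ^ 6 * tₘ⁻¹ + Real.pi / (7 - 1) * 2 ^ 12 * tₘ⁻¹ ^ 7), by positivity, ?_⟩
  intro c eu τ hτ w
  have ht : 0 < |τ| := htₘ.trans_le hτ
  have hτ0 : τ ≠ 0 := abs_pos.1 ht
  have n3 := hbl_norm_fourier_powerKernel_le hV (s := 3) (n := 4) (by norm_num) (by norm_num) hτ0 w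
  have n6 := hbl_norm_fourier_powerKernel_le hV (s := 6) (n := 10) (by norm_num) (by norm_num) hτ0 w
  have n4 := hbl_norm_fourier_powerKernel_le hV (s := 4) (n := 6) (by norm_num) (by norm_num) hτ0 w
  have n7 := hbl_norm_fourier_powerKernel_le hV (s := 7) (n := 12) (by norm_num) (by norm_num) hτ0 w
  rw [hbl_fourierIntegral_slice' hV c eu hτ0 w]
  set F3 : ℂ := 𝓕 (fun v : V => (((‖v‖ ^ 2 + τ ^ 2) ^ (-(3 : ℝ)) : ℝ) : ℂ)) w
  set F6 : ℂ := 𝓕 (fun v : V => (((‖v‖ ^ 2 + τ ^ 2) ^ (-(6 : ℝ)) : ℝ) : ℂ)) w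
  set F4 : ℂ := 𝓕 (fun v : V => (((‖v‖ ^ 2 + τ ^ 2) ^ (-(4 : ℝ)) : ℝ) : ℂ)) w
  set F7 : ℂ := 𝓕 (fun v : V => (((‖v‖ ^ 2 + τ ^ 2) ^ (-(7 : ℝ)) : ℝ) : ℂ)) w
  set u : ℝ := |τ|⁻¹
  set E : ℝ := Real.exp (-(Real.pi * ‖w‖ * |τ|))
  have hu : 0 < u := inv_pos.2 ht
  have hE : 0 < E := Real.exp_pos _
  have hut : u ≤ tₘ⁻¹ := inv_anti₀ htₘ hτ
  have htu : |τ| * u = 1 := mul_inv_cancel₀ ht.ne'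
  have hcw : ‖-((Real.pi : ℂ) * Complex.I * ((⟪c, w⟫ : ℝ) : ℂ))‖ ≤ Real.pi * (‖c‖ * ‖w‖) := by
    rw [norm_neg, norm_mul, norm_mul, Complex.norm_real, Complex.norm_I, mul_one,
      Complex.norm_real, Real.norm_of_nonneg Real.pi_pos.le, Real.norm_eq_abs]
    exact mul_le_mul_of_nonneg_left (abs_real_inner_le_norm c w) Real.pi_pos.le
  have hτeu : ‖((τ * eu : ℝ) : ℂ)‖ = |τ| * |eu| := by
    rw [Complex.norm_real, Real.norm_eq_abs, abs_mul]
  have hA : ‖(1 / 3 : ℂ) * F3 - (1 / 6 : ℂ) * F6‖ ≤ 1 / 3 * ‖F3‖ + 1 / 6 * ‖F6‖ := by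
    refine (norm_sub_le _ _).trans_eq ?_
    rw [norm_mul, norm_mul]
    norm_num
  have hB : ‖F4 - F7‖ ≤ ‖F4‖ + ‖F7‖ := norm_sub_le _ _
  have hK1 : 0 ≤ Real.pi *
      (Real.pi / (3 - 1) * 2 ^ 4 / 3 + Real.pi / (6 - 1) * 2 ^ 10 / 6 * tₘ⁻¹ ^ 6) * |eu| := by
    positivity
  have hK2 : 0 ≤ (Real.pi / (4 - 1) * 2 ^ 6 * tₘ⁻¹ + Real.pi / (7 - 1) * 2 ^ 12 * tₘ⁻¹ ^ 7) *
      (‖c‖ * ‖w‖) := by positivity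
  calc _ ≤ Real.pi * (‖c‖ * ‖w‖) * (1 / 3 * ‖F3‖ + 1 / 6 * ‖F6‖) + |τ| * |eu| * (‖F4‖ + ‖F7‖) := by
        refine (norm_add_le _ _).trans ?_
        rw [norm_mul, norm_mul, hτeu]
        gcongr
    _ ≤ Real.pi * (‖c‖ * ‖w‖) * (1 / 3 * (Real.pi / (3 - 1) * 2 ^ 4 * u ^ 4 * E) +
            1 / 6 * (Real.pi / (6 - 1) * 2 ^ 10 * u ^ 10 * E)) +
          |τ| * |eu| *
            (Real.pi / (4 - 1) * 2 ^ 6 * u ^ 6 * E + Real.pi / (7 - 1) * 2 ^ 12 * u ^ 12 * E) :=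
        add_le_add
          (mul_le_mul_of_nonneg_left (add_le_add (mul_le_mul_of_nonneg_left n3 (by norm_num))
            (mul_le_mul_of_nonneg_left n6 (by norm_num))) (by positivity))
          (mul_le_mul_of_nonneg_left (add_le_add n4 n7) (by positivity))
    _ = (Real.pi * (Real.pi / (3 - 1) * 2 ^ 4 / 3 + Real.pi / (6 - 1) * 2 ^ 10 / 6 * u ^ 6) *
            (‖c‖ * ‖w‖) +
          (Real.pi / (4 - 1) * 2 ^ 6 * u + Real.pi / (7 - 1) * 2 ^ 12 * u ^ 7) * (|τ| * u * |eu|)) *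
            u ^ 4 * E := by
        ring
    _ ≤ (Real.pi * (Real.pi / (3 - 1) * 2 ^ 4 / 3 + Real.pi / (6 - 1) * 2 ^ 10 / 6 * tₘ⁻¹ ^ 6) *
            (‖c‖ * ‖w‖) +
          (Real.pi / (4 - 1) * 2 ^ 6 * tₘ⁻¹ + Real.pi / (7 - 1) * 2 ^ 12 * tₘ⁻¹ ^ 7) * |eu|) *
            u ^ 4 * E := by
        rw [htu, one_mul]
        gcongr
    _ ≤ _ := by
        gcongr ?_ * _ * _
        linarith

end Slice

end Summit.AtomisticToContinuum.Crystallization.Theorems.HolmgrenBoyleLind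

end
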